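import Mathlib.Analysis.Complex.Polynomial.Basic
import HarnessLib

/-!
# A complex polynomial has a root of modulus `≤ deg · |a₀| / |a₁|`

Helper for the unit case of line `dim2_cases` (crux `GrenetZeon.TwoDimCoefficients`,
stmt-ValiantsHypothesis-8062): the "small root" lemma that produces zeros of `det A` converging to a
Mignon–Ressayre point at infinity.  For `h ∈ ℂ[X]` with `h'(0) = a₁ ≠ 0` and `N = deg h`, some root
`τ` satisfies `|τ| · |a₁| ≤ N · |a₀|` (`a₀ = h(0)`): indeed `a₁ / a₀ = -Σⱼ 1/τⱼ` over the roots, so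
some `|1/τⱼ| ≥ |a₁| / (N |a₀|)`.  The proof below is the elementary induction on the degree (split off
one root `τ₁`; if it is large, the cofactor has `|b₀| = |a₀|/|τ₁|` small and `|b₁|` not too small).

HONEST FRAMING: elementary analysis; serves an ASIDE item; nothing here bears on `VP ≠ VNP`.

References: folklore (Vieta's formulas); M. Marden, *Geometry of Polynomials*, AMS 1966, §27
(bounds for the zeros in terms of two coefficients), for context only.
-/

set_option linter.dupNamespace false

noncomputable section

namespace Summit.ValiantsHypothesis.ValiantsHypothesis.Cruxes.TwoDimCoefficients.DimTwoCases

open Polynomial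

/-- **Small-root lemma.** A complex polynomial `h` of degree `N` with `h.coeff 1 ≠ 0` has a root
`τ` with `‖τ‖ · ‖h.coeff 1‖ ≤ N · ‖h.coeff 0‖`. -/
theorem exists_isRoot_norm_mul_le :
    ∀ (N : ℕ) (h : ℂ[X]), h.natDegree = N → h.coeff 1 ≠ 0 →
      ∃ τ : ℂ, h.IsRoot τ ∧ ‖τ‖ * ‖h.coeff 1‖ ≤ N * ‖h.coeff 0‖ := by
  intro N
  induction N using Nat.strong_induction_on with
  | _ N ih =>
  intro h hN h1
  by_cases h0 : h.coeff 0 = 0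
  · refine ⟨0, ?_, by rw [norm_zero, zero_mul]; positivity⟩
    rw [IsRoot, ← coeff_zero_eq_eval_zero, h0]
  -- `N ≥ 1`, so `h` has a root `τ₁ ≠ 0`
  have hN1 : 1 ≤ N := hN ▸ le_natDegree_of_ne_zero h1
  obtain ⟨τ₁, hτ₁⟩ := Complex.exists_root
    (natDegree_pos_iff_degree_pos.mp (by omega : 0 < h.natDegree))
  have hτ₁0 : τ₁ ≠ 0 := by
    rintro rfl
    apply h0
    rwa [coeff_zero_eq_eval_zero]
  set h₁ := h /ₘ (X - C τ₁) with hh₁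
  have hfac : (X - C τ₁) * h₁ = h := mul_divByMonic_eq_iff_isRoot.mpr hτ₁
  have hc0 : h.coeff 0 = -(τ₁ * h₁.coeff 0) := by
    rw [← hfac, sub_mul, coeff_sub, coeff_X_mul_zero, coeff_C_mul, zero_sub]
  have hc1 : h.coeff 1 = h₁.coeff 0 - τ₁ * h₁.coeff 1 := by
    rw [← hfac, sub_mul, coeff_sub, coeff_X_mul, coeff_C_mul]
  have hdeg₁ : h₁.natDegree = N - 1 := by
    rw [hh₁, natDegree_divByMonic _ (monic_X_sub_C τ₁), natDegree_X_sub_C, hN]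
  -- the three moduli
  set t : ℝ := ‖τ₁‖ with ht
  set a0 : ℝ := ‖h.coeff 0‖ with ha0
  set a1 : ℝ := ‖h.coeff 1‖ with ha1
  have htpos : 0 < t := norm_pos_iff.mpr hτ₁0
  have ha0pos : 0 < a0 := norm_pos_iff.mpr h0
  have ha1pos : 0 < a1 := norm_pos_iff.mpr h1
  have hb0 : t * ‖h₁.coeff 0‖ = a0 := by rw [ha0, hc0, norm_neg, norm_mul]
  by_cases hsmall : t * a1 ≤ N * a0
  · exact ⟨τ₁, hτ₁, hsmall⟩
  push Not at hsmall
  -- `|b₀ - a₁| = t |b₁|`, hence `t a₁ - a₀ ≤ t² |b₁|`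
  have hb1 : t * a1 - a0 ≤ t * (t * ‖h₁.coeff 1‖) := by
    have e : h₁.coeff 0 - h.coeff 1 = τ₁ * h₁.coeff 1 := by rw [hc1]; ring
    have := norm_sub_norm_le (h.coeff 1) (h₁.coeff 0)
    rw [← norm_neg (h.coeff 1 - h₁.coeff 0), neg_sub, e, norm_mul] at this
    nlinarith [hb0, this]
  -- `N = 1` is impossible here: then `h₁` is constant and `t a₁ = a₀`
  rcases Nat.lt_or_ge N 2 with hN2 | hN2
  · exfalso
    have hN' : N = 1 := by omega
    have hcst : h₁.coeff 1 = 0 := by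
      apply coeff_eq_zero_of_natDegree_lt
      rw [hdeg₁, hN']; norm_num
    have : a1 = ‖h₁.coeff 0‖ := by rw [ha1, hc1, hcst, mul_zero, sub_zero]
    have : t * a1 = a0 := by rw [this, hb0]
    rw [hN'] at hsmall
    simp only [Nat.cast_one, one_mul] at hsmall
    linarith
  -- `N ≥ 2`: induction on the cofactor `h₁`
  have hb1ne : h₁.coeff 1 ≠ 0 := by
    intro hz
    rw [hz, norm_zero, mul_zero, mul_zero] at hb1
    have : (N : ℝ) * a0 < t * a1 := hsmall
    have hN' : (1 : ℝ) ≤ N := by exact_mod_cast hN1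
    nlinarith
  obtain ⟨τ, hτ, hbound⟩ := ih (N - 1) (by omega) h₁ hdeg₁ hb1ne
  refine ⟨τ, ?_, ?_⟩
  · rw [← hfac]; exact root_mul.mpr (Or.inr hτ)
  · -- bookkeeping: `u (t a₁ - a₀) ≤ (N-1) t a₀` and `N a₀ < t a₁` give `u a₁ ≤ N a₀`
    set u : ℝ := ‖τ‖ with hu
    set B1 : ℝ := ‖h₁.coeff 1‖ with hB1
    set B0 : ℝ := ‖h₁.coeff 0‖ with hB0
    have hu0 : 0 ≤ u := norm_nonneg _
    have hcast : ((N - 1 : ℕ) : ℝ) = (N : ℝ) - 1 := by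
      rw [Nat.cast_sub hN1, Nat.cast_one]
    rw [hcast] at hbound
    -- hbound : u * B1 ≤ (N - 1) * B0
    have hs : 0 < t * a1 - a0 := by
      have : (N : ℝ) * a0 < t * a1 := hsmall
      have hN' : (2 : ℝ) ≤ N := by exact_mod_cast hN2
      nlinarith
    have h1' : u * (t * a1 - a0) ≤ ((N : ℝ) - 1) * t * a0 := by
      calc u * (t * a1 - a0) ≤ u * (t * (t * B1)) := mul_le_mul_of_nonneg_left hb1 hu0
        _ = t * t * (u * B1) := by ring
        _ ≤ t * t * (((N : ℝ) - 1) * B0) :=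
            mul_le_mul_of_nonneg_left hbound (mul_nonneg htpos.le htpos.le)
        _ = ((N : ℝ) - 1) * t * (t * B0) := by ring
        _ = ((N : ℝ) - 1) * t * a0 := by rw [hb0]
    have h2' : ((N : ℝ) - 1) * t * a0 * a1 ≤ (N : ℝ) * a0 * (t * a1 - a0) := by
      have : (N : ℝ) * a0 < t * a1 := hsmall
      nlinarith [ha0pos.le, ha1pos.le, htpos.le]
    have h3' : u * a1 * (t * a1 - a0) ≤ (N : ℝ) * a0 * (t * a1 - a0) := by
      calc u * a1 * (t * a1 - a0) = u * (t * a1 - a0) * a1 := by ring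
        _ ≤ ((N : ℝ) - 1) * t * a0 * a1 := mul_le_mul_of_nonneg_right h1' ha1pos.le
        _ ≤ (N : ℝ) * a0 * (t * a1 - a0) := h2'
    exact le_of_mul_le_mul_right h3' hs

end Summit.ValiantsHypothesis.ValiantsHypothesis.Cruxes.TwoDimCoefficients.DimTwoCases
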